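import Literature.MathematicalPhysics.QuantumFieldTheory.Balaban1983to89.B9Eq349KernelCompositionZd
import Literature.MathematicalPhysics.QuantumFieldTheory.Balaban1983to89.B9Eq325QGGQInvZd

/-!
# `Balaban1983to89.B9Eq325QGGQMajorantZd` — [Balaban1985BackgroundPropagators] (3.25) p. 394 ∕ Thm 3.2 p. 398: AN ALMOST-LOCAL BLOCK MAJORANT OF `Q′G′(U₀)²Q′*`
# ON THE LEVEL DATA `L²(𝔅, ·)` OF THE `ℤᵈ` FRAME FROM THE DECAY OF `G′(U₀)` — the displayed input of the station-2 reduction `B9Eq325QGGQDecayOfCoerciveZd`: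
# if the blocks of `G′(U₀)` obey `|(G′δ_{x′}v)(x)|_τ ≤ C·e^{−κ|x−x′|_∞}·|v|_τ` (this seat's `B9Thm31GpDecayPlaqClosedZd` on the closed small-field class), then
# `|(Q′G′²Q′* δ_{(j′,y′)}w)(j,y)|_τ ≤ C²·K_d(κ∕2)·(2Lᵐ+1)^{2d}·e^{κ(2Lᵐ)}·e^{−(κ∕2)|Lʲy − L^{j′}y′|_∞}·|w|_τ`

statement-level skeleton of published theorems with citation tags; proofs where landed; nothing here is a claim about the
Yang–Mills mass gap

`[Balaban1985BackgroundPropagators]` ("B9", CMP **99** (1985) 389–434): (3.25) p. 394 (`Q′G′²Q′*` inside `R = I − G′Q′*(Q′G′²Q′*)⁻¹Q′G′`), (3.19) p. 393 (`Q′_j(U)`, the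
`Lʲ`-blocks), Thm 3.1 ∕ (3.42) p. 397 (decay of `G′`), Thm 3.2 p. 398 (the model `QGQ*` and its inverse), Thm 3.10 (3.107)–(3.108) pp. 415–416 (products of
localized kernels).  HERE: kinematic bookkeeping at a finite member — `Q′*` of a single constraint datum lives on one `L^{j′}`-block with `|·|_τ ≤ |w|_τ`, `G′`
decays (displayed, this seat's FILE E supplies it), two `G′` compose at half the rate (this seat's `B9Eq349KernelCompositionZd`), `Q′_j` averages over one
`Lʲ`-block; the constants are crude and member-dependent, NOT print's.

CITATION HEADER (lean-in-tree rule).  Cell `pub-ymgap` (YM Track A, HUMAN RULING D-0062 ∕ D-0149 width push), DAG node N06 = [B9], width seat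
`pub-ymgap-dag-n06-w2` (g4), CLAIM-7.  Inputs BY NAME: dag-n06-w4 g2's `B9Eq325QGGQInvZd.{levSupp, QprimeVec, QprimeStar, QprimeStar_coe, qggq, qggq_apply}`,
`B9Eq324DeltaPrimeAZd.{GpZd, transposeOn, single, QprimeLin, restrictSite}`, this seat's `B9Eq342CombesThomasFormZd.{fnorm, blockAt, apply_eq_sum_blockAt, fnorm_sum_le …}`,
`B9Thm31GpDecayOfCoerciveZd.{QprimeIter_single_eq_zero, fnorm_QprimeIter_single_le, fnorm_transposeOn_le_of_bound, linfDist_le_of_blockMap_iterate_eq,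
card_filter_linfDist_le, fnorm_conjR_of_unitary}`, `B9Eq349KernelCompositionZd.{exp_mul_exp_le_half, sum_exp_neg_mul_linfDist_le}`.  Nothing restated.

WHAT IS PROVED (kernel, 0 sorry, 0 def).
* §1 `iterate_blockMap_loc` (`(blockMap L)^[j](Lʲ·y) = y`), `linfDist_loc_lt_of_iterate_eq` (a fine site of the `j`-block of `y` is within `Lʲ` of the corner `Lʲ·y`),
  `card_filter_iterate_eq_le` (the block has `≤ (2Lʲ+1)ᵈ` sites in any finite `s`).
* §2 ★ `fnorm_QprimeStar_levSingle_le` — `Q′*` of the single constraint datum `δ_{(j′,y′)}w` is supported on the `L^{j′}`-block of `y′` (inside `Ω₀`) with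
  `|·|_τ ≤ |w|_τ` (unitary averaged transporters at the levels `< m`).
* §3 ★ `fnorm_QprimeIter_le_sum` — `|(Q′_j f)(c)|_τ ≤ Σ_{z∈s, (blockMap L)^[j]z = c} |f(z)|_τ` for `f` supported in `s` (weights `L⁻ᵈ ≤ 1`, isometric conjugations).
* §4 `fnorm_apply_le_sum_of_blockDecay` — `|(Gf)(x)|_τ ≤ Σ_{x′∈s} C e^{−κ|x−x′|_∞}|f(x′)|_τ` for an operator of `L²(Ω₀,·)` with decaying blocks.
* §5 ★★★ `fnorm_qggq_levSingle_le` — THE MAJORANT: for `p = (j,y)`, `p′ = (j′,y′)` in `𝔅`, `ψ` with underlying function `δ_{p′}w`, a displayed block decay of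
  `G′(U₀)` at rate `κ > 0` with constant `C ≥ 0`:
  `|(Q′G′²Q′*ψ)(p)|_τ ≤ C²·K_d(κ∕2)·((2Lᵐ+1)ᵈ)²·e^{κ·2Lᵐ}·e^{−(κ∕2)|Lʲy − L^{j′}y′|_∞}·|w|_τ` (`K_d` of `B9Eq349KernelCompositionZd`).

HONEST SCOPE.  Kinematics + the displayed decay of `G′`; crude constants (`(2Lᵐ+1)^{2d}`, `e^{2κLᵐ}`), member-dependent; no estimate of [B9] proved; the rows ∕ columns and
the window `ϱ < c` are the consumer's (`B9Eq325QGGQDecayOfCoerciveZd` + `B9Eq349KernelCompositionZd.rowsum_expMajorant_le_linear`).  Count-neutral; N05 ∕ N06 NOT discharged;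
K1⁸ `stmt-QuantumFields-26907` NOT closed; one finite `𝕋⁴` programme at fixed `ε`, Bałaban as printed; R4 closes only the conditional finite-`𝕋⁴` rung
`BalabanLadder.UV` — nothing continuum ∕ ℝ⁴ ∕ OS ∕ mass gap ∕ Clay.  Unit `pub-ymgap-dag-n06-w2` (g4), 2026-08-28.
-/

noncomputable section

open scoped BigOperators Nat

namespace Literature.MathematicalPhysics.QuantumFieldTheory.Balaban1983to89.B9Eq325QGGQMajorantZd

open Literature.MathematicalPhysics.QuantumLattice (blockSites blockBase blockMap mem_blockSites_iff)
open B7Eq78Linearization (conjR QprimeIter QprimeIter_zero QprimeIter_succ Qprime_apply zdBlocking)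
open B7Prop2Explicit (unitaryUnits)
open B8Eq119TwistedAxial (bgT)
open B9Eq321LandauProjectionZd (suppSub)
open B9Eq324DeltaPrimeAZd (single eq_sum_single restrictSite restrictSite_coe transposeOn QprimeLin QprimeLin_apply GpZd)
open B9Eq325QGGQInvZd (levSupp QprimeVec QprimeStar QprimeStar_coe qggq qggq_apply)
open B9Eq342CombesThomasFormZd (fnorm fnorm_nonneg fnorm_zero fnorm_smul fnorm_sum_le fnorm_eq_zero_iff blockAt blockAt_def apply_eq_sum_blockAt
  single_apply_self single_apply_of_ne)
open B9Thm31GpDecayOfCoerciveZd (QprimeIter_single_eq_zero fnorm_QprimeIter_single_le fnorm_transposeOn_le_of_bound linfDist_le_of_blockMap_iterate_eq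
  card_filter_linfDist_le fnorm_conjR_of_unitary fnorm_single_le)
open B9Eq349KernelCompositionZd (exp_mul_exp_le_half sum_exp_neg_mul_linfDist_le)
open LatticeNorms (linfDist linfDist_le_iff)

export B7Prop1Explicit (Site)

variable {d : ℕ} {𝔸 : Type*} [CStarAlgebra 𝔸]

/-! ## §1  Geometry of the level blocks: the corner `Lʲ·y`, distances, counts -/

section Geometry

variable {L : ℕ}

/-- `blockMap L (L·z) = z` coordinatewise (`L ≥ 1`). [folklore] [cite: Balaban1985Averaging, (78) p.30 (bookkeeping)] -/
theorem blockMap_smul_site (hL : 1 ≤ L) (z : Site d) : blockMap L (fun i => (L : ℤ) * z i) = z := by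
  funext i
  have hL0 : (L : ℤ) ≠ 0 := by exact_mod_cast (by omega : L ≠ 0)
  show (L : ℤ) * z i / (L : ℤ) = z i
  exact Int.mul_ediv_cancel_left _ hL0

/-- **THE CORNER `Lʲ·y` HAS `j`-FOLD BLOCK INDEX `y`**: `(blockMap L)^[j] (Lʲ·y) = y`. [folklore] [cite: Balaban1985BackgroundPropagators, (3.19) p.393 (bookkeeping)] -/
theorem iterate_blockMap_loc (hL : 1 ≤ L) : ∀ (j : ℕ) (y : Site d), (blockMap L)^[j] (fun i => ((L : ℤ) ^ j) * y i) = y := by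
  intro j
  induction j with
  | zero => intro y; funext i; simp
  | succ j ih =>
    intro y
    rw [Function.iterate_succ_apply]
    have h : blockMap L (fun i => ((L : ℤ) ^ (j + 1)) * y i) = fun i => ((L : ℤ) ^ j) * y i := by
      have := blockMap_smul_site hL (fun i => ((L : ℤ) ^ j) * y i)
      refine Eq.trans ?_ this
      congr 1; funext i; ring
    rw [h, ih]

/-- a site of the `j`-block of `y` is within `Lʲ` of the corner: `|z − Lʲy|_∞ + 1 ≤ Lʲ`. [cite: Balaban1985BackgroundPropagators, (3.19) p.393 (bookkeeping)] -/
theorem linfDist_loc_lt_of_iterate_eq (hL : 1 ≤ L) {j : ℕ} {z y : Site d} (hz : (blockMap L)^[j] z = y) :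
    linfDist z (fun i => ((L : ℤ) ^ j) * y i) + 1 ≤ L ^ j :=
  linfDist_le_of_blockMap_iterate_eq hL j (by rw [hz, iterate_blockMap_loc hL j y])

/-- the `j`-block of `y` meets a finite `s` in at most `(2Lʲ+1)ᵈ` sites. [cite: Balaban1985BackgroundPropagators, (3.19) p.393 (bookkeeping)] -/
theorem card_filter_iterate_eq_le (hL : 1 ≤ L) (s : Finset (Site d)) (j : ℕ) (y : Site d) :
    (s.filter (fun z => (blockMap L)^[j] z = y)).card ≤ (2 * L ^ j + 1) ^ d := by
  classical
  refine le_trans (Finset.card_le_card fun z hz => ?_) (card_filter_linfDist_le s (fun i => ((L : ℤ) ^ j) * y i) (L ^ j))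
  rw [Finset.mem_filter] at hz ⊢
  refine ⟨hz.1, ?_⟩
  rw [LatticeNorms.linfDist_comm]
  have := linfDist_loc_lt_of_iterate_eq hL hz.2
  omega

end Geometry

/-! ## §2  `Q′*` of a single constraint datum -/

section QStar

variable (L : ℕ) (U₀ : Site d → Fin d → 𝔸ˣ) (τ : 𝔸 →ₗ[ℂ] ℂ) [FiniteDimensional ℝ 𝔸] (hτp : ∀ a : 𝔸, a ≠ 0 → 0 < (τ (star a * a)).re)
  (m : ℕ) (Λ : ℕ → Finset (Site d)) (s : Finset (Site d))

/-- the transpose of the zero function vanishes. [cite: Balaban1985BackgroundPropagators, (3.24) p.394 (bookkeeping)] -/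
theorem transposeOn_zero (S : (Site d → 𝔸) →ₗ[ℝ] (Site d → 𝔸)) (Λ' : Finset (Site d)) :
    transposeOn τ hτp S Λ' (0 : Site d → 𝔸) = 0 := by
  have h := B9Eq324DeltaPrimeAZd.transposeOn_smul τ hτp S Λ' (0 : ℝ) (0 : Site d → 𝔸)
  rwa [zero_smul, zero_smul] at h

/-- ★ **`Q′*` OF THE SINGLE CONSTRAINT DATUM `δ_{(j′,y′)}w`** (`j′ ≤ m`, unitary averaged transporters at the levels `< m`, `L ≥ 1`, faithful Hermitian tracial `τ`):
at a fine site `x′` it vanishes unless `x′ ∈ Ω₀` and `(blockMap L)^[j′]x′ = y′`, and there `|·|_τ ≤ |w|_τ`.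
[cite: Balaban1985BackgroundPropagators, (3.25) p.394 («Q′*»), (3.19) p.393, (3.24) p.394] -/
theorem fnorm_QprimeStar_levSingle_le (hτt : ∀ a b : 𝔸, τ (a * b) = τ (b * a)) (hτs : ∀ a : 𝔸, τ (star a) = starRingEnd ℂ (τ a)) (hL : 1 ≤ L)
    (hT : ∀ j', j' < m → ∀ c x, bgT L U₀ j' c x ∈ unitaryUnits 𝔸) {ψ : levSupp (𝔸 := 𝔸) m Λ} {j' : ℕ} {y' : Site d} {w : 𝔸}
    (hj' : j' ≤ m) (hψ : (ψ : ℕ × Site d → 𝔸) = single (j', y') w) (x' : Site d) :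
    fnorm τ ((QprimeStar L U₀ τ m Λ s hτp ψ : Site d → 𝔸) x') ≤
      (if x' ∈ s ∧ (blockMap L)^[j'] x' = y' then fnorm τ w else 0) := by
  classical
  rw [QprimeStar_coe, hψ]
  -- only the level `j′` contributes: the other levels read the zero function
  have hlev : ∀ j ∈ Finset.range (m + 1), (fun y => single (j', y') w (j, y)) = if j = j' then single y' w else 0 := by
    intro j _
    funext y
    by_cases h : j = j'
    · subst h
      rw [if_pos rfl]
      by_cases hy : y = y'
      · subst hy; rw [single_apply_self]; simp [single]
      · rw [single_apply_of_ne hy]; simp [single, hy]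
    · rw [if_neg h, Pi.zero_apply]; simp [single, h]
  have hsum : (∑ j ∈ Finset.range (m + 1), transposeOn τ hτp (QprimeLin L U₀ j) (Λ j) (fun y => single (j', y') w (j, y))) =
      transposeOn τ hτp (QprimeLin L U₀ j') (Λ j') (single y' w) := by
    rw [Finset.sum_congr rfl (g := fun j => if j = j' then transposeOn τ hτp (QprimeLin L U₀ j) (Λ j) (single y' w) else 0) ?_,
      Finset.sum_ite_eq', if_pos (Finset.mem_range.mpr (Nat.lt_succ_of_le hj'))]
    intro j hj
    rw [hlev j hj]
    split_ifs with h
    · rfl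
    · exact transposeOn_zero τ hτp _ _
  by_cases hx : x' ∈ s
  · rw [Set.indicator_of_mem (Finset.mem_coe.mpr hx), hsum]
    have hTj : ∀ j'', j'' < j' → ∀ c x, bgT L U₀ j'' c x ∈ unitaryUnits 𝔸 := fun j'' hj'' => hT j'' (by omega)
    -- the Riesz bound: only `c = y′` contributes, with `|(Q′_{j′}δ_{x′}X)(y′)|_τ ≤ [block]·|X|_τ`
    have hb : ∀ X : 𝔸, |∑ c ∈ Λ j', (τ (star (QprimeLin L U₀ j' (single x' X) c) * single y' w c)).re| ≤
        (if (blockMap L)^[j'] x' = y' then fnorm τ w else 0) * fnorm τ X := by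
      intro X
      have hterm : ∀ c ∈ Λ j', (τ (star (QprimeLin L U₀ j' (single x' X) c) * single y' w c)).re =
          if c = y' then (τ (star (QprimeLin L U₀ j' (single x' X) y') * w)).re else 0 := by
        intro c _
        by_cases hc : c = y'
        · subst hc; rw [if_pos rfl, single_apply_self]
        · rw [if_neg hc, single_apply_of_ne hc, mul_zero, map_zero, Complex.zero_re]
      rw [Finset.sum_congr rfl hterm, Finset.sum_ite_eq']
      by_cases hy' : y' ∈ Λ j'
      · rw [if_pos hy']
        refine (B9Eq342CombesThomasFormZd.abs_fibreForm_le hτp hτs _ _).trans ?_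
        rw [QprimeLin_apply, mul_comm]
        by_cases hblk : (blockMap L)^[j'] x' = y'
        · rw [if_pos hblk]
          exact mul_le_mul_of_nonneg_left (fnorm_QprimeIter_single_le τ (bgT L U₀) hτt hL x' X j' hTj y') (fnorm_nonneg τ _)
        · rw [if_neg hblk, QprimeIter_single_eq_zero (bgT L U₀) hL x' X j' y' (Ne.symm hblk), fnorm_zero, mul_zero, zero_mul]
      · rw [if_neg hy', abs_zero]
        exact mul_nonneg (by split_ifs <;> [exact fnorm_nonneg τ w; exact le_rfl]) (fnorm_nonneg τ X)
    have key := fnorm_transposeOn_le_of_bound τ hτp (QprimeLin L U₀ j') (Λ j') (single y' w) x'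
      (C := if (blockMap L)^[j'] x' = y' then fnorm τ w else 0) (by split_ifs <;> [exact fnorm_nonneg τ w; exact le_rfl]) hb
    by_cases hblk : (blockMap L)^[j'] x' = y'
    · rw [if_pos ⟨hx, hblk⟩]; rw [if_pos hblk] at key; exact key
    · rw [if_neg (fun h => hblk h.2)]; rw [if_neg hblk] at key; exact key
  · rw [Set.indicator_of_notMem (fun h => hx (Finset.mem_coe.mp h)), fnorm_zero, if_neg (fun h => hx h.1)]

end QStar

/-! ## §3  `Q′_j` of a function supported in `Ω₀` is bounded by the block sum -/

section QIter

variable (τ : 𝔸 →ₗ[ℂ] ℂ) {L : ℕ} (T : ℕ → Site d → Site d → 𝔸ˣ)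

/-- ★ **`|(Q′_j f)(c)|_τ ≤ Σ_{z∈s, (blockMap L)^[j]z = c} |f(z)|_τ`** for `f` vanishing off the finite `s` (unitary transporters at the levels `< j`, `L ≥ 1`; the
averaging weights `L⁻ᵈ ≤ 1` are dropped). [cite: Balaban1985BackgroundPropagators, (3.19) p.393; Balaban1985Averaging, (78) p.30] -/
theorem fnorm_QprimeIter_le_sum (hτp : ∀ a : 𝔸, a ≠ 0 → 0 < (τ (star a * a)).re) (hτt : ∀ a b : 𝔸, τ (a * b) = τ (b * a))
    (hτs : ∀ a : 𝔸, τ (star a) = starRingEnd ℂ (τ a)) (hL : 1 ≤ L) (s : Finset (Site d)) {f : Site d → 𝔸} (hf : ∀ z, z ∉ s → f z = 0) :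
    ∀ j : ℕ, (∀ j', j' < j → ∀ c x, T j' c x ∈ unitaryUnits 𝔸) → ∀ c : Site d,
      fnorm τ (QprimeIter (zdBlocking d L) T j f c) ≤ ∑ z ∈ s.filter (fun z => (blockMap L)^[j] z = c), fnorm τ (f z) := by
  classical
  haveI : NeZero L := ⟨by omega⟩
  intro j
  induction j with
  | zero =>
    intro _ c
    rw [QprimeIter_zero]
    by_cases hc : c ∈ s
    · have hmem : c ∈ s.filter (fun z => (blockMap L)^[0] z = c) := by rw [Finset.mem_filter]; exact ⟨hc, rfl⟩
      exact Finset.single_le_sum (f := fun z => fnorm τ (f z)) (fun z _ => fnorm_nonneg τ _) hmem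
    · rw [hf c hc, fnorm_zero]; exact Finset.sum_nonneg fun z _ => fnorm_nonneg τ _
  | succ j ih =>
    intro hT c
    have hTj : ∀ j', j' < j → ∀ c x, T j' c x ∈ unitaryUnits 𝔸 := fun j' hj' => hT j' (Nat.lt_succ_of_lt hj')
    rw [QprimeIter_succ, Qprime_apply]
    have hB : (zdBlocking d L).B j c = blockSites L c := rfl
    rw [hB]
    refine (fnorm_sum_le hτp hτs _ _).trans ?_
    have hstep : ∀ x ∈ blockSites L c, fnorm τ ((zdBlocking d L).wt j c x • conjR (T j c x) (QprimeIter (zdBlocking d L) T j f x)) ≤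
        ∑ z ∈ s.filter (fun z => (blockMap L)^[j] z = x), fnorm τ (f z) := by
      intro x _
      have hwt : (zdBlocking d L).wt j c x = ((L : ℝ) ^ d)⁻¹ := rfl
      rw [hwt, fnorm_smul, fnorm_conjR_of_unitary τ hτt (hT j (Nat.lt_succ_self j) c x)]
      have hle1 : |((L : ℝ) ^ d)⁻¹| ≤ 1 := by
        rw [abs_of_pos (by positivity)]
        exact inv_le_one_of_one_le₀ (one_le_pow₀ (by exact_mod_cast hL))
      calc |((L : ℝ) ^ d)⁻¹| * fnorm τ (QprimeIter (zdBlocking d L) T j f x) ≤ 1 * fnorm τ (QprimeIter (zdBlocking d L) T j f x) :=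
            mul_le_mul_of_nonneg_right hle1 (fnorm_nonneg τ _)
        _ ≤ ∑ z ∈ s.filter (fun z => (blockMap L)^[j] z = x), fnorm τ (f z) := by rw [one_mul]; exact ih hTj x
    refine (Finset.sum_le_sum hstep).trans (le_of_eq ?_)
    -- regroup the block sums: the fibres of `(blockMap L)^[j]` over `blockSites L c` partition the fibre of `(blockMap L)^[j+1]` over `c`
    rw [← Finset.sum_fiberwise_of_maps_to (s := s.filter (fun z => (blockMap L)^[j + 1] z = c)) (t := blockSites L c)
      (g := fun z => (blockMap L)^[j] z) (f := fun z => fnorm τ (f z)) ?_]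
    · refine Finset.sum_congr rfl fun x hx => Finset.sum_congr ?_ fun _ _ => rfl
      ext z
      simp only [Finset.mem_filter]
      constructor
      · rintro ⟨hz, hzx⟩
        refine ⟨⟨hz, ?_⟩, hzx⟩
        rw [Function.iterate_succ_apply', hzx]
        exact (mem_blockSites_iff L c x).1 hx
      · rintro ⟨⟨hz, _⟩, hzx⟩
        exact ⟨hz, hzx⟩
    · intro z hz
      rw [Finset.mem_filter] at hz
      have h2 := hz.2
      rw [Function.iterate_succ_apply'] at h2
      rw [mem_blockSites_iff]
      exact h2

end QIter

/-! ## §4  An operator of `L²(Ω₀, ·)` with decaying blocks, applied to a general field -/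

section Apply

variable (τ : 𝔸 →ₗ[ℂ] ℂ) {s : Finset (Site d)}

/-- **`|(Gf)(x)|_τ ≤ Σ_{x′∈s} C e^{−κ|x−x′|_∞}·|f(x′)|_τ`** for an ℝ-linear `G` of `L²(Ω₀, ·)` whose blocks obey `|(Gδ_{x′}v)(x)|_τ ≤ C e^{−κ|x−x′|_∞}|v|_τ`.
[cite: Balaban1985BackgroundPropagators, (3.42) p.397, (3.107)–(3.108) pp.415–416] -/
theorem fnorm_apply_le_sum_of_blockDecay (hτp : ∀ a : 𝔸, a ≠ 0 → 0 < (τ (star a * a)).re) (hτs : ∀ a : 𝔸, τ (star a) = starRingEnd ℂ (τ a))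
    (G : suppSub (𝔸 := 𝔸) s →ₗ[ℝ] suppSub (𝔸 := 𝔸) s) {C κ : ℝ}
    (hG : ∀ x' ∈ s, ∀ (v : 𝔸) (x : Site d), fnorm τ (blockAt s G x' v x) ≤ C * Real.exp (-(κ * (linfDist x x' : ℝ))) * fnorm τ v)
    (f : suppSub (𝔸 := 𝔸) s) (x : Site d) :
    fnorm τ ((G f : Site d → 𝔸) x) ≤ ∑ x' ∈ s, C * Real.exp (-(κ * (linfDist x x' : ℝ))) * fnorm τ ((f : Site d → 𝔸) x') := by
  rw [apply_eq_sum_blockAt]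
  exact (fnorm_sum_le hτp hτs _ _).trans (Finset.sum_le_sum fun x' hx' => hG x' hx' _ x)

end Apply

/-! ## §5  ★★★ The almost-local majorant of `Q′G′²Q′*` -/

section Majorant

variable (L : ℕ) (U₀ : Site d → Fin d → 𝔸ˣ) (η : ℝ) (τ : 𝔸 →ₗ[ℂ] ℂ) [FiniteDimensional ℝ 𝔸]
  (hτp : ∀ a : 𝔸, a ≠ 0 → 0 < (τ (star a * a)).re) (m : ℕ) (a : ℕ → ℝ) (Λ : ℕ → Finset (Site d)) (s : Finset (Site d))
  (hd : 0 < d) (hη : η ≠ 0) (hτt : ∀ a b : 𝔸, τ (a * b) = τ (b * a)) (hτs : ∀ a : 𝔸, τ (star a) = starRingEnd ℂ (τ a))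
  (hU : ∀ (x : Site d) (κ : Fin d), U₀ x κ ∈ unitaryUnits 𝔸) (ha : ∀ j, 0 ≤ a j)

/-- ★★★ **THE ALMOST-LOCAL BLOCK MAJORANT OF `Q′G′(U₀)²Q′*` FROM THE DECAY OF `G′(U₀)`.**  Every unitary `U₀` with unitary averaged transporters at the levels
`< m`, `a ≥ 0`, finite `Ω₀ = s`, `1 ≤ L`, faithful Hermitian tracial `τ`; suppose the blocks of `G′(U₀)` decay: `|(G′δ_{x′}v)(x)|_τ ≤ C·e^{−κ|x−x′|_∞}·|v|_τ`
(`C ≥ 0`, `κ > 0`, `x′ ∈ Ω₀`).  Then for constraint points `p = (j, y)`, `p′ = (j′, y′)` with `j, j′ ≤ m` and every `ψ ∈ L²(𝔅, ·)` with underlying function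
`δ_{p′}w`:  `|(Q′G′²Q′*ψ)(p)|_τ ≤ C²·K_d(κ∕2)·((2Lᵐ+1)ᵈ)²·e^{κ·2Lᵐ}·e^{−(κ∕2)|Lʲy − L^{j′}y′|_∞}·|w|_τ`, `K_d(μ) = 3ᵈ·d!·(2∕μ)ᵈ·e^{μ∕2}∕(1 − e^{−μ∕2})`.
[cite: Balaban1985BackgroundPropagators, (3.25) p.394, (3.19) p.393, (3.42) p.397, Thm 3.2 p.398, (3.107)–(3.108) pp.415–416] -/
theorem fnorm_qggq_levSingle_le (hL : 1 ≤ L) (hT : ∀ j', j' < m → ∀ c x, bgT L U₀ j' c x ∈ unitaryUnits 𝔸) {C κ : ℝ} (hC : 0 ≤ C) (hκ : 0 < κ)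
    (hG : ∀ x' ∈ s, ∀ (v : 𝔸) (x : Site d),
      fnorm τ (blockAt s (GpZd L U₀ η τ hτp m a Λ s hd hη hτt hτs hU ha).toLinearMap x' v x) ≤ C * Real.exp (-(κ * (linfDist x x' : ℝ))) * fnorm τ v)
    {j j' : ℕ} (hj : j ≤ m) (hj' : j' ≤ m) (y y' : Site d) {ψ : levSupp (𝔸 := 𝔸) m Λ} {w : 𝔸}
    (hψ : (ψ : ℕ × Site d → 𝔸) = single (j', y') w) :
    fnorm τ ((qggq L U₀ η τ hτp m a Λ s hd hη hτt hτs hU ha ψ : ℕ × Site d → 𝔸) (j, y)) ≤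
      C ^ 2 * ((3 : ℝ) ^ d * (d ! : ℝ) * (2 / (κ / 2)) ^ d * Real.exp (κ / 2 / 2) / (1 - Real.exp (-(κ / 2 / 2)))) *
        (((2 * L ^ m + 1) ^ d : ℕ) : ℝ) ^ 2 * Real.exp (κ * (2 * (L ^ m : ℕ))) *
        Real.exp (-(κ / 2 * (linfDist (fun i => ((L : ℤ) ^ j) * y i) (fun i => ((L : ℤ) ^ j') * y' i) : ℝ))) * fnorm τ w := by
  classical
  set Kd : ℝ := (3 : ℝ) ^ d * (d ! : ℝ) * (2 / (κ / 2)) ^ d * Real.exp (κ / 2 / 2) / (1 - Real.exp (-(κ / 2 / 2))) with hKd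
  set N : ℝ := (((2 * L ^ m + 1) ^ d : ℕ) : ℝ) with hN
  set loc : Site d := fun i => ((L : ℤ) ^ j) * y i with hloc
  set loc' : Site d := fun i => ((L : ℤ) ^ j') * y' i with hloc'
  set G := (GpZd L U₀ η τ hτp m a Λ s hd hη hτt hτs hU ha).toLinearMap with hGdef
  set u := QprimeStar L U₀ τ m Λ s hτp ψ with hu
  have hKd0 : 0 ≤ Kd := by
    have h := sum_exp_neg_mul_linfDist_le (d := d) (half_pos hκ) ∅ loc
    rw [Finset.sum_empty] at h
    exact h
  -- Step 1: `Q′*ψ` lives on the `j′`-block of `y′` with `|·|_τ ≤ |w|_τ`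
  have h1 : ∀ x', fnorm τ ((u : Site d → 𝔸) x') ≤ (if x' ∈ s ∧ (blockMap L)^[j'] x' = y' then fnorm τ w else 0) :=
    fun x' => fnorm_QprimeStar_levSingle_le L U₀ τ hτp m Λ s hτt hτs hL hT hj' hψ x'
  -- Step 2: one `G′`
  have h2 : ∀ x1, fnorm τ ((G u : Site d → 𝔸) x1) ≤ C * fnorm τ w * ∑ x' ∈ s.filter (fun z => (blockMap L)^[j'] z = y'), Real.exp (-(κ * (linfDist x1 x' : ℝ))) := by
    intro x1
    refine (fnorm_apply_le_sum_of_blockDecay τ hτp hτs G hG u x1).trans ?_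
    rw [Finset.mul_sum, ← Finset.sum_filter_add_sum_filter_not s (fun z => (blockMap L)^[j'] z = y')]
    have hzero : ∑ x' ∈ s.filter (fun z => ¬ (blockMap L)^[j'] z = y'), C * Real.exp (-(κ * (linfDist x1 x' : ℝ))) * fnorm τ ((u : Site d → 𝔸) x') = 0 := by
      refine Finset.sum_eq_zero fun x' hx' => ?_
      rw [Finset.mem_filter] at hx'
      have h0 : fnorm τ ((u : Site d → 𝔸) x') = 0 := le_antisymm ((h1 x').trans (by rw [if_neg (fun h => hx'.2 h.2)])) (fnorm_nonneg τ _)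
      rw [h0, mul_zero]
    rw [hzero, add_zero]
    refine Finset.sum_le_sum fun x' hx' => ?_
    rw [Finset.mem_filter] at hx'
    have hux : fnorm τ ((u : Site d → 𝔸) x') ≤ fnorm τ w := (h1 x').trans (by rw [if_pos hx'])
    calc C * Real.exp (-(κ * (linfDist x1 x' : ℝ))) * fnorm τ ((u : Site d → 𝔸) x') ≤ C * Real.exp (-(κ * (linfDist x1 x' : ℝ))) * fnorm τ w :=
          mul_le_mul_of_nonneg_left hux (by positivity)
      _ = C * fnorm τ w * Real.exp (-(κ * (linfDist x1 x' : ℝ))) := by ring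
  -- Step 3: the second `G′` and the composition at half the rate
  have h3 : ∀ x, fnorm τ ((G (G u) : Site d → 𝔸) x) ≤
      C ^ 2 * Kd * fnorm τ w * ∑ x' ∈ s.filter (fun z => (blockMap L)^[j'] z = y'), Real.exp (-(κ / 2 * (linfDist x x' : ℝ))) := by
    intro x
    refine (fnorm_apply_le_sum_of_blockDecay τ hτp hτs G hG (G u) x).trans ?_
    have hdist0 : ∀ a b : Site d, (0 : ℝ) ≤ (linfDist a b : ℝ) := fun a b => Nat.cast_nonneg _
    have hdt : ∀ a b c : Site d, (linfDist a c : ℝ) ≤ (linfDist a b : ℝ) + (linfDist b c : ℝ) :=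
      fun a b c => by exact_mod_cast LatticeNorms.linfDist_triangle a b c
    calc ∑ x1 ∈ s, C * Real.exp (-(κ * (linfDist x x1 : ℝ))) * fnorm τ ((G u : Site d → 𝔸) x1)
        ≤ ∑ x1 ∈ s, C * Real.exp (-(κ * (linfDist x x1 : ℝ))) *
            (C * fnorm τ w * ∑ x' ∈ s.filter (fun z => (blockMap L)^[j'] z = y'), Real.exp (-(κ * (linfDist x1 x' : ℝ)))) :=
          Finset.sum_le_sum fun x1 _ => mul_le_mul_of_nonneg_left (h2 x1) (by positivity)
      _ = C ^ 2 * fnorm τ w * ∑ x' ∈ s.filter (fun z => (blockMap L)^[j'] z = y'),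
            ∑ x1 ∈ s, Real.exp (-(κ * (linfDist x x1 : ℝ))) * Real.exp (-(κ * (linfDist x1 x' : ℝ))) := by
          have hx1 : ∀ x1 ∈ s, C * Real.exp (-(κ * (linfDist x x1 : ℝ))) *
              (C * fnorm τ w * ∑ x' ∈ s.filter (fun z => (blockMap L)^[j'] z = y'), Real.exp (-(κ * (linfDist x1 x' : ℝ)))) =
              ∑ x' ∈ s.filter (fun z => (blockMap L)^[j'] z = y'),
                C ^ 2 * fnorm τ w * (Real.exp (-(κ * (linfDist x x1 : ℝ))) * Real.exp (-(κ * (linfDist x1 x' : ℝ)))) := by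
            intro x1 _
            rw [Finset.mul_sum, Finset.mul_sum]
            exact Finset.sum_congr rfl fun _ _ => by ring
          rw [Finset.sum_congr rfl hx1, Finset.sum_comm, Finset.mul_sum]
          exact Finset.sum_congr rfl fun x' _ => by rw [Finset.mul_sum]
      _ ≤ C ^ 2 * fnorm τ w * ∑ x' ∈ s.filter (fun z => (blockMap L)^[j'] z = y'),
            (Real.exp (-(κ / 2 * (linfDist x x' : ℝ))) * ∑ x1 ∈ s, Real.exp (-(κ / 2 * (linfDist x x1 : ℝ)))) := by
          refine mul_le_mul_of_nonneg_left (Finset.sum_le_sum fun x' _ => ?_) (mul_nonneg (pow_nonneg hC 2) (fnorm_nonneg τ w))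
          rw [Finset.mul_sum]
          exact Finset.sum_le_sum fun x1 _ => exp_mul_exp_le_half hdist0 hdt hκ.le x x1 x'
      _ ≤ C ^ 2 * fnorm τ w * ∑ x' ∈ s.filter (fun z => (blockMap L)^[j'] z = y'), (Real.exp (-(κ / 2 * (linfDist x x' : ℝ))) * Kd) := by
          refine mul_le_mul_of_nonneg_left (Finset.sum_le_sum fun x' _ => ?_) (mul_nonneg (pow_nonneg hC 2) (fnorm_nonneg τ w))
          exact mul_le_mul_of_nonneg_left (by rw [hKd]; exact sum_exp_neg_mul_linfDist_le (half_pos hκ) s x) (Real.exp_pos _).le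
      _ = C ^ 2 * Kd * fnorm τ w * ∑ x' ∈ s.filter (fun z => (blockMap L)^[j'] z = y'), Real.exp (-(κ / 2 * (linfDist x x' : ℝ))) := by
          rw [← Finset.sum_mul]; ring
  -- Step 4: `Q′_j` at `(j, y)` and the block geometry
  have hGGu : ∀ z, z ∉ s → (G (G u) : Site d → 𝔸) z = 0 := fun z hz => (G (G u)).2 z hz
  have h4 : fnorm τ ((qggq L U₀ η τ hτp m a Λ s hd hη hτt hτs hU ha ψ : ℕ × Site d → 𝔸) (j, y)) ≤
      ∑ z ∈ s.filter (fun z => (blockMap L)^[j] z = y), fnorm τ ((G (G u) : Site d → 𝔸) z) := by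
    rw [qggq_apply]
    show fnorm τ (if (j, y).1 ∈ Finset.range (m + 1) ∧ (j, y).2 ∈ Λ (j, y).1 then
      QprimeIter (zdBlocking d L) (bgT L U₀) (j, y).1 ((G (G u) : suppSub (𝔸 := 𝔸) s) : Site d → 𝔸) (j, y).2 else 0) ≤ _
    split_ifs with hmem
    · have hTj : ∀ j'', j'' < j → ∀ c x, bgT L U₀ j'' c x ∈ unitaryUnits 𝔸 := fun j'' hj'' => hT j'' (by omega)
      exact fnorm_QprimeIter_le_sum τ (bgT L U₀) hτp hτt hτs hL s hGGu j hTj y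
    · rw [fnorm_zero]; exact Finset.sum_nonneg fun z _ => fnorm_nonneg τ _
  -- Step 5: the double block sum
  have hblk : ∀ z ∈ s.filter (fun z => (blockMap L)^[j] z = y), ∀ x' ∈ s.filter (fun z => (blockMap L)^[j'] z = y'),
      Real.exp (-(κ / 2 * (linfDist z x' : ℝ))) ≤ Real.exp (κ * (2 * (L ^ m : ℕ))) * Real.exp (-(κ / 2 * (linfDist loc loc' : ℝ))) := by
    intro z hz x' hx'
    rw [Finset.mem_filter] at hz hx'
    rw [← Real.exp_add, Real.exp_le_exp]
    have hz1 : linfDist z loc + 1 ≤ L ^ j := linfDist_loc_lt_of_iterate_eq hL hz.2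
    have hx1 : linfDist x' loc' + 1 ≤ L ^ j' := linfDist_loc_lt_of_iterate_eq hL hx'.2
    have hLj : L ^ j ≤ L ^ m := Nat.pow_le_pow_right hL hj
    have hLj' : L ^ j' ≤ L ^ m := Nat.pow_le_pow_right hL hj'
    have t1 := LatticeNorms.linfDist_triangle loc z loc'
    have t2 := LatticeNorms.linfDist_triangle z x' loc'
    have c1 : linfDist loc z = linfDist z loc := LatticeNorms.linfDist_comm _ _
    have hcast : (linfDist loc loc' : ℝ) ≤ (linfDist z x' : ℝ) + 2 * (L ^ m : ℕ) := by
      have : linfDist loc loc' ≤ linfDist z x' + 2 * L ^ m := by omega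
      exact_mod_cast this
    nlinarith [hκ.le, hcast]
  have hcardz : ((s.filter (fun z => (blockMap L)^[j] z = y)).card : ℝ) ≤ N := by
    rw [hN]
    have h := card_filter_iterate_eq_le hL s j y
    have h' : (2 * L ^ j + 1) ^ d ≤ (2 * L ^ m + 1) ^ d := Nat.pow_le_pow_left (by linarith [Nat.pow_le_pow_right hL hj]) d
    exact_mod_cast h.trans h'
  have hcardx : ((s.filter (fun z => (blockMap L)^[j'] z = y')).card : ℝ) ≤ N := by
    rw [hN]
    have h := card_filter_iterate_eq_le hL s j' y'
    have h' : (2 * L ^ j' + 1) ^ d ≤ (2 * L ^ m + 1) ^ d := Nat.pow_le_pow_left (by linarith [Nat.pow_le_pow_right hL hj']) d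
    exact_mod_cast h.trans h'
  set E := Real.exp (κ * (2 * (L ^ m : ℕ))) * Real.exp (-(κ / 2 * (linfDist loc loc' : ℝ))) with hE
  have hE0 : 0 ≤ E := by positivity
  calc fnorm τ ((qggq L U₀ η τ hτp m a Λ s hd hη hτt hτs hU ha ψ : ℕ × Site d → 𝔸) (j, y))
      ≤ ∑ z ∈ s.filter (fun z => (blockMap L)^[j] z = y), fnorm τ ((G (G u) : Site d → 𝔸) z) := h4
    _ ≤ ∑ z ∈ s.filter (fun z => (blockMap L)^[j] z = y),
          C ^ 2 * Kd * fnorm τ w * ∑ x' ∈ s.filter (fun z => (blockMap L)^[j'] z = y'), Real.exp (-(κ / 2 * (linfDist z x' : ℝ))) :=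
        Finset.sum_le_sum fun z _ => h3 z
    _ ≤ ∑ z ∈ s.filter (fun z => (blockMap L)^[j] z = y),
          C ^ 2 * Kd * fnorm τ w * ∑ x' ∈ s.filter (fun z => (blockMap L)^[j'] z = y'), E := by
        refine Finset.sum_le_sum fun z hz => mul_le_mul_of_nonneg_left (Finset.sum_le_sum fun x' hx' => hblk z hz x' hx') ?_
        exact mul_nonneg (mul_nonneg (by positivity) hKd0) (fnorm_nonneg τ w)
    _ = ((s.filter (fun z => (blockMap L)^[j] z = y)).card : ℝ) * (((s.filter (fun z => (blockMap L)^[j'] z = y')).card : ℝ) *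
          (C ^ 2 * Kd * fnorm τ w * E)) := by
        rw [Finset.sum_const, nsmul_eq_mul, Finset.sum_const, nsmul_eq_mul]; ring
    _ ≤ N * (N * (C ^ 2 * Kd * fnorm τ w * E)) := by
        have hin : 0 ≤ C ^ 2 * Kd * fnorm τ w * E := mul_nonneg (mul_nonneg (mul_nonneg (by positivity) hKd0) (fnorm_nonneg τ w)) hE0
        exact mul_le_mul hcardz (mul_le_mul_of_nonneg_right hcardx hin) (mul_nonneg (Nat.cast_nonneg _) hin) (hN ▸ Nat.cast_nonneg _)
    _ = C ^ 2 * Kd * N ^ 2 * Real.exp (κ * (2 * (L ^ m : ℕ))) * Real.exp (-(κ / 2 * (linfDist loc loc' : ℝ))) * fnorm τ w := by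
        rw [hE]; ring

end Majorant

end Literature.MathematicalPhysics.QuantumFieldTheory.Balaban1983to89.B9Eq325QGGQMajorantZd

end
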